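import Literature.MathematicalPhysics.QuantumFieldTheory.King1986.CompositionLaw
import HarnessLib

/-!
# `UnitScaleTiltFluctuationComparisonRegPrTwoCutoffSymbolHeightFree` — THE HEIGHT-FREE REFERENCE OBJECT OF THE K1a ROW AT THE BOTTOM (SYMBOL) LAYER:
# the `k → ∞` limit of King's level-`k` effective Laplacian symbol EXISTS and every level is within `C·L^{−2k}` of it (relative), hypothesis-free
# (crux `FluctuationComparisonRegPrIntL`, stmt-QuantumFields-20520, STUB 3⁗χ; cell `pub/ym-inputs`, INPUT-LIST I-11 row p10 «K-uniform two-cut-off propagator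
# estimate behind `FlatKernelLegCauchyΦ`»; seat ym-inputs-p10, count-neutral helper, def-free)

WHY.  The two-run K1a row `GlobalSlackKernelLeg.FlatKernelLegCauchyΦ` (`…GlobalSlackKernelLegWeights`) is supplied, by name, through the PER-RUN reference form
`KernelRefΦ D Φ Ψ …` against a HEIGHT-FREE reference family `Ψ` (`KerHeightFree Ψ`, `flatKernelLegCauchyΦ_of_ref`, `…GlobalSlackKernelLegRef`; display row (R1)
`KernelRefOwnΦ`, `…GlobalSlackKernelLegRefOwn`) — [King1986]'s mechanism read as «each run's `k`-step objects are within `L^{−γk}` of the `n → ∞` LIMIT objects».  The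
reference objects are to be tree definitions; none exists yet at any layer.  The lowest layer of every chart kernel is the propagator ∕ covariance layer, whose flat
`A = 0` template the tree PROVES ([King1986] §4: `King1986.CompositionLaw.lemma43_aK` = Lemma 4.3 ∕ Prop. 3.10 (3.91), a TWO-RUN statement, uniform in the number `n`
of extra slices).  This file turns that uniform two-run statement into the REFERENCE FORM at the symbol layer, for King's actual level symbols
`Δ^{(k)}(p′) = DeltaEff (aK a L k) (L^k) M p′` ((4.5) p.670 with the constants `a_k` of (2.13) p.653):

* §1 `abs_sub_le_uniform` — the two-run bound with ONE constant `C(a, L) = 2a((a(1 − L⁻²))⁻¹ + π²∕48 + 1∕3)` for all `k, n ≥ 1` (`a_k ≤ a`, `a_n ≥ a(1 − L⁻²)`);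
* §2 `cauchySeq_levelSymbol`, **`exists_heightFree_limit`** — the level symbols form a Cauchy sequence; there is `Δ^{(∞)}(p′) ∈ [0, a]` with `Δ^{(k)}(p′) → Δ^{(∞)}(p′)`
  and the PER-RUN RATE `|Δ^{(k)}(p′) − Δ^{(∞)}(p′)| ≤ C(a, L)·L^{−2k}·Δ^{(k)}(p′)` for EVERY `k ≥ 1`, uniformly in the dimension, the mass `M ≥ 0` and `p′ ≠ 0` in
  `[−π, π]^d` (completeness of `ℝ` + closedness of the bound along `n → ∞`);
* §3 `abs_sub_le_of_reference` — the two-run bound RECOVERED from the reference form by the triangle inequality (the pattern of `flatKernelLegCauchyΦ_of_ref` one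
  layer down), so that nothing is lost by recording only the per-run row.

HONEST FRAMING.  A limit theorem about the FLAT, ABELIAN, `A = 0` template objects of [King1986] §4 (the tree's `King1986/*`, cell pub-balaban), i.e. the symbol of the
block-averaging effective Laplacian; it is NOT the non-abelian `d = 3` statement behind `FlatKernelLegCauchyΦ` (Bałaban's `G_k(Ω; U₀)` at a curved background has no
carrier in the tree and no printed two-cut-off estimate — INPUT-LIST I-11 flag, KILL-TEST E2 = NO), and it touches neither the stub, the crux, nor the (α) record.
Nothing of [Balaban1985UV3] ∕ [King1986] is asserted: the only inputs are the tree's PROVED `lemma43_aK`, `DeltaEff_pos`, `DeltaEff_le`, `aK_pos`, `aK_le`, `aK_ge`.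
YM₃ on T³ (route `UnitScaleTilt`) is a ladder rung, not the Clay problem, not 𝕋⁴, not a mass gap; no summit or sub-problem statement is proved here.

References: C. King, CMP 102 (1986) 649–677 [King1986] ((2.13) p.653, Prop. 3.6 (3.56) p.662, (3.58)–(3.61) p.663, Prop. 3.10 (3.91) p.669, (4.5) p.670, Lemma 4.3
(4.18) p.672; p.657 «Hence {Z^{ε_K}} is a Cauchy sequence and converges to a unique limit»).
-/

set_option autoImplicit false

noncomputable section

open Filter Topology Real
open Literature.MathematicalPhysics.QuantumFieldTheory.King1986

namespace Summit.QuantumFields.YangMills.Theorems.TwoCutoffSymbolHeightFree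

variable {dd : ℕ}

/-! ## §1 The two-run bound with one constant, uniform in `k, n ≥ 1` -/

/-- `1 < L` as reals for `2 ≤ L`. [folklore] -/
theorem one_lt_cast {L : ℕ} (hL : 2 ≤ L) : (1 : ℝ) < (L : ℝ) := by exact_mod_cast hL

/-- The uniform constant is nonnegative: `0 ≤ 2a((a(1 − L⁻²))⁻¹ + π²∕48 + 1∕3)`. [folklore] -/
theorem const_nonneg {a : ℝ} (ha : 0 < a) {L : ℕ} (hL : 2 ≤ L) :
    0 ≤ 2 * a * ((a * (1 - ((L : ℝ) ^ 2)⁻¹))⁻¹ + π ^ 2 / 48 + 1 / 3) := by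
  have hL1 := one_lt_cast hL
  have h1 : 0 < 1 - ((L : ℝ) ^ 2)⁻¹ := by
    have := one_sub_inv_pow_pos hL1 (k := 1) le_rfl
    simpa using this
  have h2 : 0 ≤ (a * (1 - ((L : ℝ) ^ 2)⁻¹))⁻¹ := inv_nonneg.mpr (mul_pos ha h1).le
  positivity

/-- **LEMMA 4.3 ∕ (3.91) WITH ONE CONSTANT FOR ALL `k, n ≥ 1`**: `|Δ^{(k)}(p′) − Δ^{(k+n)}(p′)| ≤ 2a((a(1 − L⁻²))⁻¹ + π²∕48 + 1∕3)·L^{−2k}·Δ^{(k)}(p′)` — the tree's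
`lemma43_aK` with `a_k ≤ a` (`aK_le`) and `a_n⁻¹ ≤ (a(1 − L⁻²))⁻¹` (`aK_ge`). [cite: King1986, Lemma 4.3 (4.18) p.672; Prop. 3.10 (3.91) p.669] -/
theorem abs_sub_le_uniform {a : ℝ} (ha : 0 < a) {L : ℕ} (hL : 2 ≤ L) {M : ℝ} (hM : 0 ≤ M) {p : Fin dd → ℝ}
    (hp : ∀ μ, |p μ| ≤ π) (hp0 : 0 < momSq p) {k n : ℕ} (hk : 1 ≤ k) (hn : 1 ≤ n) :
    |DeltaEff (aK a L k) (L ^ k) M p - DeltaEff (aK a L (k + n)) (L ^ (k + n)) M p|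
      ≤ 2 * a * ((a * (1 - ((L : ℝ) ^ 2)⁻¹))⁻¹ + π ^ 2 / 48 + 1 / 3) * (((L : ℝ) ^ k) ^ 2)⁻¹ * DeltaEff (aK a L k) (L ^ k) M p := by
  have hL1 := one_lt_cast hL
  have h43 := lemma43_aK (M := M) ha hL hk hn hM hp hp0
  rw [show L ^ n * L ^ k = L ^ (k + n) by rw [pow_add, mul_comm]] at h43
  refine h43.trans ?_
  have hN : 1 ≤ L ^ k := Nat.one_le_pow k L (by omega)
  have hΔ : 0 ≤ DeltaEff (aK a L k) (L ^ k) M p := (DeltaEff_pos (aK_pos ha hL1 hk) hN hM hp hp0).le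
  have hak : aK a L k ≤ a := aK_le ha hL1 hk
  have hak0 : 0 ≤ aK a L k := (aK_pos ha hL1 hk).le
  have h1 : 0 < 1 - ((L : ℝ) ^ 2)⁻¹ := by
    have := one_sub_inv_pow_pos hL1 (k := 1) le_rfl
    simpa using this
  have han : (aK a L n)⁻¹ ≤ (a * (1 - ((L : ℝ) ^ 2)⁻¹))⁻¹ := inv_anti₀ (mul_pos ha h1) (aK_ge ha hL1 hn)
  have hcast : (((L ^ k : ℕ) : ℝ) ^ 2)⁻¹ = (((L : ℝ) ^ k) ^ 2)⁻¹ := by push_cast; ring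
  rw [hcast]
  have hx : 0 ≤ (((L : ℝ) ^ k) ^ 2)⁻¹ := by positivity
  have hB : 0 ≤ (aK a L n)⁻¹ + π ^ 2 / 48 + 1 / 3 := by
    have : 0 ≤ (aK a L n)⁻¹ := inv_nonneg.mpr (aK_pos ha hL1 hn).le
    positivity
  have hstep : aK a L k * (2 * (((aK a L n)⁻¹ + π ^ 2 / 48 + 1 / 3) * (((L : ℝ) ^ k) ^ 2)⁻¹))
      ≤ 2 * a * ((a * (1 - ((L : ℝ) ^ 2)⁻¹))⁻¹ + π ^ 2 / 48 + 1 / 3) * (((L : ℝ) ^ k) ^ 2)⁻¹ := by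
    have e1 : aK a L k * (2 * (((aK a L n)⁻¹ + π ^ 2 / 48 + 1 / 3) * (((L : ℝ) ^ k) ^ 2)⁻¹))
        = 2 * aK a L k * ((aK a L n)⁻¹ + π ^ 2 / 48 + 1 / 3) * (((L : ℝ) ^ k) ^ 2)⁻¹ := by ring
    rw [e1]
    have h2 : 2 * aK a L k * ((aK a L n)⁻¹ + π ^ 2 / 48 + 1 / 3) ≤ 2 * a * ((a * (1 - ((L : ℝ) ^ 2)⁻¹))⁻¹ + π ^ 2 / 48 + 1 / 3) := by
      have h3 : 2 * aK a L k * ((aK a L n)⁻¹ + π ^ 2 / 48 + 1 / 3) ≤ 2 * a * ((aK a L n)⁻¹ + π ^ 2 / 48 + 1 / 3) :=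
        mul_le_mul_of_nonneg_right (by linarith) hB
      have h4 : 2 * a * ((aK a L n)⁻¹ + π ^ 2 / 48 + 1 / 3) ≤ 2 * a * ((a * (1 - ((L : ℝ) ^ 2)⁻¹))⁻¹ + π ^ 2 / 48 + 1 / 3) :=
        mul_le_mul_of_nonneg_left (by linarith) (by positivity)
      exact h3.trans h4
    exact mul_le_mul_of_nonneg_right h2 hx
  exact mul_le_mul_of_nonneg_right hstep hΔ

/-- `0 < Δ^{(k)}(p′) ≤ a` for `k ≥ 1` (`DeltaEff_pos`, `DeltaEff_le`, `aK_le`). [cite: King1986, Prop. 3.10 p.669 («|Δ^{(k)}(p)| ≤ C uniformly in k»)] -/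
theorem levelSymbol_pos_le {a : ℝ} (ha : 0 < a) {L : ℕ} (hL : 2 ≤ L) {M : ℝ} (hM : 0 ≤ M) {p : Fin dd → ℝ}
    (hp : ∀ μ, |p μ| ≤ π) (hp0 : 0 < momSq p) {k : ℕ} (hk : 1 ≤ k) :
    0 < DeltaEff (aK a L k) (L ^ k) M p ∧ DeltaEff (aK a L k) (L ^ k) M p ≤ a := by
  have hL1 := one_lt_cast hL
  have hN : 1 ≤ L ^ k := Nat.one_le_pow k L (by omega)
  exact ⟨DeltaEff_pos (aK_pos ha hL1 hk) hN hM hp hp0, (DeltaEff_le (aK_pos ha hL1 hk) (L ^ k) hM p).trans (aK_le ha hL1 hk)⟩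

/-- The two-run bound in ABSOLUTE form: `|Δ^{(k)} − Δ^{(k+n)}| ≤ C(a,L)·a·(L⁻²)^k` for `k, n ≥ 1`. [cite: King1986, Lemma 4.3 (4.18) p.672] -/
theorem abs_sub_le_geometric {a : ℝ} (ha : 0 < a) {L : ℕ} (hL : 2 ≤ L) {M : ℝ} (hM : 0 ≤ M) {p : Fin dd → ℝ}
    (hp : ∀ μ, |p μ| ≤ π) (hp0 : 0 < momSq p) {k n : ℕ} (hk : 1 ≤ k) (hn : 1 ≤ n) :
    |DeltaEff (aK a L k) (L ^ k) M p - DeltaEff (aK a L (k + n)) (L ^ (k + n)) M p|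
      ≤ 2 * a * ((a * (1 - ((L : ℝ) ^ 2)⁻¹))⁻¹ + π ^ 2 / 48 + 1 / 3) * a * (((L : ℝ) ^ 2)⁻¹) ^ k := by
  refine (abs_sub_le_uniform ha hL hM hp hp0 hk hn).trans ?_
  have hC := const_nonneg ha hL
  obtain ⟨hpos, hle⟩ := levelSymbol_pos_le ha hL hM hp hp0 hk
  have hx : (((L : ℝ) ^ k) ^ 2)⁻¹ = (((L : ℝ) ^ 2)⁻¹) ^ k := by rw [← pow_mul, mul_comm, pow_mul, inv_pow]
  rw [hx]
  have hr : 0 ≤ (((L : ℝ) ^ 2)⁻¹) ^ k := by positivity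
  calc 2 * a * ((a * (1 - ((L : ℝ) ^ 2)⁻¹))⁻¹ + π ^ 2 / 48 + 1 / 3) * (((L : ℝ) ^ 2)⁻¹) ^ k * DeltaEff (aK a L k) (L ^ k) M p
      ≤ 2 * a * ((a * (1 - ((L : ℝ) ^ 2)⁻¹))⁻¹ + π ^ 2 / 48 + 1 / 3) * (((L : ℝ) ^ 2)⁻¹) ^ k * a :=
        mul_le_mul_of_nonneg_left hle (mul_nonneg hC hr)
    _ = 2 * a * ((a * (1 - ((L : ℝ) ^ 2)⁻¹))⁻¹ + π ^ 2 / 48 + 1 / 3) * a * (((L : ℝ) ^ 2)⁻¹) ^ k := by ring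

/-! ## §2 The height-free limit symbol and the per-run rate -/

/-- **THE LEVEL SYMBOLS FORM A CAUCHY SEQUENCE** (shifted to start at `k = 1`): consecutive levels differ by `≤ C(a,L)·a·L⁻²·(L⁻²)^m` (§1 with `n = 1`).
[cite: King1986, Lemma 4.3 (4.18) p.672; p.657 («is a Cauchy sequence»)] -/
theorem cauchySeq_levelSymbol {a : ℝ} (ha : 0 < a) {L : ℕ} (hL : 2 ≤ L) {M : ℝ} (hM : 0 ≤ M) {p : Fin dd → ℝ}
    (hp : ∀ μ, |p μ| ≤ π) (hp0 : 0 < momSq p) :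
    CauchySeq fun m : ℕ => DeltaEff (aK a L (m + 1)) (L ^ (m + 1)) M p := by
  have hL1 := one_lt_cast hL
  have hr1 : ((L : ℝ) ^ 2)⁻¹ < 1 := inv_lt_one_of_one_lt₀ (by nlinarith)
  refine cauchySeq_of_le_geometric (((L : ℝ) ^ 2)⁻¹)
    (2 * a * ((a * (1 - ((L : ℝ) ^ 2)⁻¹))⁻¹ + π ^ 2 / 48 + 1 / 3) * a * ((L : ℝ) ^ 2)⁻¹) hr1 fun m => ?_
  rw [Real.dist_eq]
  have h := abs_sub_le_geometric ha hL hM hp hp0 (k := m + 1) (n := 1) (by omega) le_rfl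
  rw [show m + 1 + 1 = m + 2 by ring] at h
  rw [show m + 1 + 1 = m + 2 by ring]
  refine h.trans (le_of_eq ?_)
  ring

/-- **THE HEIGHT-FREE REFERENCE SYMBOL EXISTS, WITH THE PER-RUN RATE — hypothesis-free.**  For `a > 0`, `L ≥ 2`, `M ≥ 0` and `p′ ≠ 0` in `[−π, π]^d` there is a real
number `Δ^{(∞)}(p′) ∈ [0, a]` such that (i) King's level symbols converge to it, `Δ^{(k)}(p′) = DeltaEff (aK a L k) (L^k) M p′ → Δ^{(∞)}(p′)` as `k → ∞`, and (ii) for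
EVERY level `k ≥ 1`, `|Δ^{(k)}(p′) − Δ^{(∞)}(p′)| ≤ 2a((a(1 − L⁻²))⁻¹ + π²∕48 + 1∕3)·L^{−2k}·Δ^{(k)}(p′)` — each run's symbol is within `C·L^{−2k}` (relative) of ONE
run-independent reference, the symbol-layer instance of `KernelRefΦ`∕`KerHeightFree`; [King1986] Prop. 3.10 read as «the `k`-step symbol is within `L^{−2k}` of the limit
symbol», uniformly in `n`. [cite: King1986, Prop. 3.10 (3.91) p.669; Lemma 4.3 (4.18) p.672; Prop. 3.6 (3.56) p.662 with (3.58)-(3.61) p.663] -/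
theorem exists_heightFree_limit {a : ℝ} (ha : 0 < a) {L : ℕ} (hL : 2 ≤ L) {M : ℝ} (hM : 0 ≤ M) {p : Fin dd → ℝ}
    (hp : ∀ μ, |p μ| ≤ π) (hp0 : 0 < momSq p) :
    ∃ Δinf : ℝ, 0 ≤ Δinf ∧ Δinf ≤ a ∧
      Tendsto (fun k : ℕ => DeltaEff (aK a L k) (L ^ k) M p) atTop (𝓝 Δinf) ∧
      ∀ k : ℕ, 1 ≤ k →
        |DeltaEff (aK a L k) (L ^ k) M p - Δinf|
          ≤ 2 * a * ((a * (1 - ((L : ℝ) ^ 2)⁻¹))⁻¹ + π ^ 2 / 48 + 1 / 3) * (((L : ℝ) ^ k) ^ 2)⁻¹ * DeltaEff (aK a L k) (L ^ k) M p := by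
  obtain ⟨Δinf, hlim1⟩ := cauchySeq_tendsto_of_complete (cauchySeq_levelSymbol ha hL hM hp hp0)
  -- the unshifted sequence has the same limit
  have hlim : Tendsto (fun k : ℕ => DeltaEff (aK a L k) (L ^ k) M p) atTop (𝓝 Δinf) :=
    (tendsto_add_atTop_iff_nat (f := fun k : ℕ => DeltaEff (aK a L k) (L ^ k) M p) 1).mp hlim1
  refine ⟨Δinf, ?_, ?_, hlim, fun k hk => ?_⟩
  · exact ge_of_tendsto' hlim1 fun m => (levelSymbol_pos_le ha hL hM hp hp0 (k := m + 1) (by omega)).1.le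
  · exact le_of_tendsto' hlim1 fun m => (levelSymbol_pos_le ha hL hM hp hp0 (k := m + 1) (by omega)).2
  · -- pass to the limit `n → ∞` in the uniform two-run bound
    have hshift : Tendsto (fun n : ℕ => DeltaEff (aK a L (k + n)) (L ^ (k + n)) M p) atTop (𝓝 Δinf) := by
      have h2 := (tendsto_add_atTop_iff_nat (f := fun j : ℕ => DeltaEff (aK a L j) (L ^ j) M p) k).mpr hlim
      refine h2.congr fun n => ?_
      simp only [Nat.add_comm n k]
    have habs : Tendsto (fun n : ℕ => |DeltaEff (aK a L k) (L ^ k) M p - DeltaEff (aK a L (k + n)) (L ^ (k + n)) M p|) atTop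
        (𝓝 |DeltaEff (aK a L k) (L ^ k) M p - Δinf|) := (tendsto_const_nhds.sub hshift).abs
    refine le_of_tendsto habs ?_
    filter_upwards [eventually_ge_atTop 1] with n hn
    exact abs_sub_le_uniform ha hL hM hp hp0 hk hn

/-- **UNIQUENESS**: the reference symbol is determined by the level symbols (limits in `ℝ` are unique) — any two numbers satisfying (i) coincide. [folklore] -/
theorem heightFree_limit_unique {a : ℝ} {L : ℕ} {M : ℝ} {p : Fin dd → ℝ} {Δ₁ Δ₂ : ℝ}
    (h₁ : Tendsto (fun k : ℕ => DeltaEff (aK a L k) (L ^ k) M p) atTop (𝓝 Δ₁))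
    (h₂ : Tendsto (fun k : ℕ => DeltaEff (aK a L k) (L ^ k) M p) atTop (𝓝 Δ₂)) : Δ₁ = Δ₂ :=
  tendsto_nhds_unique h₁ h₂

/-! ## §3 The two-run bound recovered from the reference form -/

/-- **TWO RUNS FROM THE REFERENCE (triangle inequality)**: if each of two levels `k ≤ k′` is within `C·L^{−2·}·Δ^{(·)}` of the same reference `Δ^{(∞)}`, then
`|Δ^{(k)} − Δ^{(k′)}| ≤ C·L^{−2k}·Δ^{(k)} + C·L^{−2k′}·Δ^{(k′)}` — the pattern of `GlobalSlackKernelLeg.flatKernelLegCauchyΦ_of_ref` at the symbol layer: recording the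
PER-RUN row loses nothing of the two-run row. [cite: King1986, Prop. 3.6 (3.56) p.662; Lemma 4.3 (4.18) p.672] -/
theorem abs_sub_le_of_reference {C Δinf : ℝ} {s : ℕ → ℝ} {r : ℕ → ℝ}
    (href : ∀ k : ℕ, 1 ≤ k → |s k - Δinf| ≤ C * r k * s k) {k k' : ℕ} (hk : 1 ≤ k) (hk' : 1 ≤ k') :
    |s k - s k'| ≤ C * r k * s k + C * r k' * s k' := by
  have h1 := href k hk
  have h2 := href k' hk'
  calc |s k - s k'| = |(s k - Δinf) - (s k' - Δinf)| := by ring_nf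
    _ ≤ |s k - Δinf| + |s k' - Δinf| := abs_sub _ _
    _ ≤ C * r k * s k + C * r k' * s k' := add_le_add h1 h2

/-- **THE TWO-RUN ROW OF RECORD, BACK FROM THE REFERENCE FORM, for King's actual level symbols**: for `1 ≤ k ≤ k′`,
`|Δ^{(k)}(p′) − Δ^{(k′)}(p′)| ≤ C(a,L)·(L^{−2k}·Δ^{(k)}(p′) + L^{−2k′}·Δ^{(k′)}(p′)) ≤ 2·C(a,L)·a·L^{−2k}` — (3.91)'s shape with the doubled constant, as
`flatKernelLegCauchyΦ_of_ref` gives `2C`. [cite: King1986, Prop. 3.10 (3.91) p.669; Prop. 3.6 (3.56) p.662] -/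
theorem abs_sub_le_twoRun_of_heightFree {a : ℝ} (ha : 0 < a) {L : ℕ} (hL : 2 ≤ L) {M : ℝ} (hM : 0 ≤ M) {p : Fin dd → ℝ}
    (hp : ∀ μ, |p μ| ≤ π) (hp0 : 0 < momSq p) {k k' : ℕ} (hk : 1 ≤ k) (hkk' : k ≤ k') :
    |DeltaEff (aK a L k) (L ^ k) M p - DeltaEff (aK a L k') (L ^ k') M p|
      ≤ 2 * (2 * a * ((a * (1 - ((L : ℝ) ^ 2)⁻¹))⁻¹ + π ^ 2 / 48 + 1 / 3)) * a * (((L : ℝ) ^ k) ^ 2)⁻¹ := by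
  obtain ⟨Δinf, -, -, -, hrate⟩ := exists_heightFree_limit ha hL hM hp hp0
  have hk' : 1 ≤ k' := hk.trans hkk'
  have htri := abs_sub_le_of_reference (s := fun j => DeltaEff (aK a L j) (L ^ j) M p) (r := fun j => (((L : ℝ) ^ j) ^ 2)⁻¹)
    (C := 2 * a * ((a * (1 - ((L : ℝ) ^ 2)⁻¹))⁻¹ + π ^ 2 / 48 + 1 / 3)) hrate hk hk'
  refine htri.trans ?_
  have hC := const_nonneg ha hL
  have hL1 := one_lt_cast hL
  obtain ⟨-, hle⟩ := levelSymbol_pos_le ha hL hM hp hp0 hk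
  obtain ⟨-, hle'⟩ := levelSymbol_pos_le ha hL hM hp hp0 hk'
  have hx : 0 ≤ (((L : ℝ) ^ k) ^ 2)⁻¹ := by positivity
  have hx' : 0 ≤ (((L : ℝ) ^ k') ^ 2)⁻¹ := by positivity
  -- `L^{−2k′} ≤ L^{−2k}`
  have hmono : (((L : ℝ) ^ k') ^ 2)⁻¹ ≤ (((L : ℝ) ^ k) ^ 2)⁻¹ := by
    apply inv_anti₀ (by positivity)
    exact pow_le_pow_left₀ (by positivity) (pow_le_pow_right₀ hL1.le hkk') 2
  set C := 2 * a * ((a * (1 - ((L : ℝ) ^ 2)⁻¹))⁻¹ + π ^ 2 / 48 + 1 / 3) with hCdef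
  calc C * (((L : ℝ) ^ k) ^ 2)⁻¹ * DeltaEff (aK a L k) (L ^ k) M p + C * (((L : ℝ) ^ k') ^ 2)⁻¹ * DeltaEff (aK a L k') (L ^ k') M p
      ≤ C * (((L : ℝ) ^ k) ^ 2)⁻¹ * a + C * (((L : ℝ) ^ k) ^ 2)⁻¹ * a := by
        refine add_le_add (mul_le_mul_of_nonneg_left hle (mul_nonneg hC hx)) ?_
        exact (mul_le_mul_of_nonneg_left hle' (mul_nonneg hC hx')).trans (mul_le_mul_of_nonneg_right (mul_le_mul_of_nonneg_left hmono hC) ha.le)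
    _ = 2 * C * a * (((L : ℝ) ^ k) ^ 2)⁻¹ := by ring

end Summit.QuantumFields.YangMills.Theorems.TwoCutoffSymbolHeightFree

end
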